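import Literature.AlgebraicGeometry.HodgeTheory.WeilClassesFieldSubfieldDecomposable
import Literature.AlgebraicGeometry.HodgeTheory.WeilClassesProductsOfFactors
import Literature.AlgebraicGeometry.HodgeTheory.WeilTypeProducts
import HarnessLib

/-!
# Weil classes of a PRODUCT with the diagonal action of `F = ℚ(φ)`: `W_F(A₁ × A₂) ⊗ ℂ` is, line by line, the
# exterior product of `W_F(A₁) ⊗ ℂ` and `W_F(A₂) ⊗ ℂ` (Moonen–Zarhin 1998 §2; Schoen's product step for any CM field)

Layer `Literature/AlgebraicGeometry/HodgeTheory`, theorem-only companion of `WeilClassesProductsOfFactors` (the same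
statement for an imaginary QUADRATIC field `K = ℚ(√-d)` on the carrier `weilClassesOf`: Schoen 1998 §10 read
downward, `W_K(A₁ × A₂) = W_K(A₁) · W_K(A₂)`) and of `WeilClassesFieldSubfieldSubalgebra` /
`WeilClassesFieldSubfieldDecomposable` (Moonen–Zarhin's Remark (1) for subfields).  THIS file treats a field
`F = ℚ(φ) ≅ ℚ[T]/(P)` of ANY degree acting on two abelian varieties `A₁`, `A₂` (`P(φ₁) = 0`, `P(φ₂) = 0`) and
diagonally on `A₁ × A₂` (`Ψ = φ₁ × φ₂`, i.e. `Ψ ≫ fst = fst ≫ φ₁`, `Ψ ≫ snd = snd ≫ φ₂`), on the carrier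
`HodgeTheory.weilClassesField` (`W_F ⊗ ℂ = ⊕_{P(ρ)=0} ⋀ʳ V_ρ`).

PRINTED STATEMENT.  B. J. J. Moonen – Yu. G. Zarhin, *Weil classes on abelian varieties*, J. reine angew. Math. 496
(1998) 83–92 = arXiv:alg-geom/9612017 (held text `paper:arxiv-alg-geom_9612017`), §2 (chunk p0002, lines 1–13):
«The condition that `1 ∈ F` acts as the identity implies that `F` acts on each factor `Y_i^{m_i}`, and that the
action of `F` on `X` is the “diagonal action” w.r.t. the decomposition.  Write `r_i = 2 m_i dim(Y_i)/[F:ℚ]`, so that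
`r = r₁ + ⋯ + r_k`.  For each factor `Y_i^{m_i}` we obtain a 1-dimensional `F`-subspace
`W_F(Y_i^{m_i}) ⊂ H^{r_i}(Y_i^{m_i}, ℚ)`.  We claim that the space `W_F(X)` can be identified with the tensor product
`W_F(Y₁^{m₁}) ⊗_F … ⊗_F W_F(Y_k^{m_k})`, considered as a subspace of the Künneth component
`H^{r₁}(Y₁^{m₁}, ℚ) ⊗_ℚ … ⊗_ℚ H^{r_k}(Y_k^{m_k}, ℚ) ⊂ H^r(X, ℚ)`.  The verification of this statement, which we leave
to the reader, is a matter of linear algebra.»  And (lines 21–31): «if `W_F(X)` consists of Hodge classes, then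
`W_F(X)` consists of decomposable Hodge classes ⟺ each of the spaces `W_F(Y_i^{m_i})` consists of decomposable Hodge
classes».  Complexified, for two factors: for every embedding `σ` (root `ρ`), `V_ρ(Ψ) = fst^* V_ρ(φ₁) ⊕ snd^* V_ρ(φ₂)`,
so `⋀^{r₁+r₂} V_ρ(Ψ) = fst^* ⋀^{r₁} V_ρ(φ₁) ⌣ snd^* ⋀^{r₂} V_ρ(φ₂)` — Schoen's display
`ω_{1,σ} ∧ ⋯ ∧ ω_{6,σ} = (ω_{1,σ} ∧ ⋯ ∧ ω_{4,σ}) ∧ (ω_{5,σ} ∧ ω_{6,σ})` (Compositio 114 §10, p. 333) for any CM field.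

WHAT IS PROVED (theorems only; no definition, no named fact).  Data: `P ∈ ℤ[T]` monic irreducible over `ℚ` of degree
`e`; `φᵢ : Aᵢ ⟶ Aᵢ` with `P(φᵢ) = 0` and `e · rᵢ = 2 dim Aᵢ`; `Ψ : A₁ × A₂ ⟶ A₁ × A₂` with `Ψ ≫ fst = fst ≫ φ₁`,
`Ψ ≫ snd = snd ≫ φ₂`.
* §1 `eval₂_prodLift_fst_snd` — `Q(Ψ) = prodLift (fst ≫ χ₁) (snd ≫ χ₂)` whenever `χᵢ = Q(φᵢ)` in `End Aᵢ`,
  `Q ∈ ℤ[T]` (the diagonal `End A₁ × End A₂ → End(A₁ × A₂)` is a ring homomorphism);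
  `eval₂_prodLift_fst_snd_eq_zero` (`P(Ψ) = 0`).
* §2 `cupProduct_map_fst_map_snd_mem_pullbackEigenclasses_pow` — `fst^* ⋀ᵏ V_ρ(φ₁) ⌣ snd^* ⋀ˡ V_ρ(φ₂) ⊆ (⋀^{k+l} V_ρ(Ψ))`-line;
  **`pullbackEigenclasses_prod_eq_span_cupProduct`** — THE `W_F(A₁ × A₂)`-LINE ABOVE `ρ` IS THE EXTERIOR PRODUCT OF THE
  `W_F(Aᵢ)`-LINES: `pullbackEigenclasses (A₁ × A₂) Ψ (r₁ + r₂) ((x + yρ)^{r₁+r₂}) = ℂ · (fst^* ω₁ ⌣ snd^* ω₂)` for any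
  non-zero `ωᵢ` on the two factor lines (membership: naturality of `⌣`; `≠ 0`: Künneth,
  `cupProduct_map_fst_map_snd_ne_zero_of_add_eq`; dimension `≤ 1`: `dim V_ρ(Ψ) = r₁ + r₂` from `P(Ψ) = 0` and
  `e(r₁ + r₂) = 2 dim(A₁ × A₂)`).
* §3 **`weilClassesField_prod_le_span_cupProduct`** — `W_F(A₁ × A₂) ⊗ ℂ ⊆ span_ℂ {fst^* a ⌣ snd^* b | a ∈ W_F(A₁) ⊗ ℂ,
  b ∈ W_F(A₂) ⊗ ℂ}` (Moonen–Zarhin's identification `W_F(X) = W_F(Y₁^{m₁}) ⊗_F W_F(Y₂^{m₂})`, complexified, as a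
  containment of the span; the mixed products `σ ≠ σ′` are not Weil classes).
* §4 consequences — THE PRODUCT STEP FOR ANY `F`: **`weilClassesField_prod_le_algebraicClasses`** (`W_F(A₁) ⊗ ℂ`,
  `W_F(A₂) ⊗ ℂ` algebraic ⟹ `W_F(A₁ × A₂) ⊗ ℂ` algebraic: exterior products of algebraic classes are algebraic,
  `cupProduct_map_fst_map_snd_mem_algebraicClasses`); **`weilClassesField_prod_le_divisorClassesSpan`** (the same for
  the divisor ring `D`: Moonen–Zarhin's «⟸» above).
* §5 POWERS with the diagonal action (`X = Y^m`, `powSuccMap φ a` on `A.powSucc a = A^{a+1}`):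
  `eval₂_powSuccMap_eq_zero` (`P(φ^{a+1}) = 0`), **`weilClassesField_powSucc_le_algebraicClasses`**,
  **`weilClassesField_powSucc_le_divisorClassesSpan`** (`W_F(A) ⊗ ℂ` algebraic / decomposable ⟹
  `W_F(A^{a+1}) ⊗ ℂ` algebraic / decomposable, degree `2(a+1)m`; induction on `a` with §4).
  Combined with `WeilClassesFieldSubfieldSubalgebra` §4 these descend further to every subfield `ℚ(S(Ψ)) ⊆ F`.

Not treated here: the «⟹» of Moonen–Zarhin's display (from the product to the factors: Schoen's UPWARD step, in the
tree for quadratic `K` as `WeilClassesProducts`); more than two non-isogenous factors at once (iterate §4).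

No `sorry`; axioms `propext`, `Classical.choice`, `Quot.sound`.

## References
* [MoonenZarhin1998WeilClasses] B. J. J. Moonen, Yu. G. Zarhin, *Weil classes on abelian varieties*, J. reine angew.
  Math. 496 (1998) 83–92 = arXiv:alg-geom/9612017, §2 (decomposition up to isogeny; chunk p0002).
* [Schoen1998HodgeWeilAddendum] C. Schoen, *Addendum to: Hodge classes on self-products of a variety with an
  automorphism*, Compositio Math. 114 (1998) 329–336, §10 (proof, p. 333).
* [Deligne1982HodgeCycles] P. Deligne (notes by J. S. Milne), LNM 900 (1982), §4 (4.3)–(4.4) (PDF p. 46).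
* [vanGeemen1994HodgeAV] B. van Geemen, LNM 1594 (1994), §2.4 (`D`), 4.9, proof of Thm. 6.12.
* [MumfordAV1970] D. Mumford, *Abelian Varieties* (1970), §19 (`Hom(C, A × B) = Hom(C, A) ⊕ Hom(C, B)`).
* [HatcherAT2002] A. Hatcher, *Algebraic Topology* (2002), §3.2 Prop. 3.10, Thm. 3.16 (Künneth).
* [VoisinHodgeII2003] C. Voisin, *Hodge Theory and Complex Algebraic Geometry II* (2003), Prop. 9.20 / §11.3.
-/

noncomputable section

open CategoryTheory Polynomial

namespace Literature.AlgebraicGeometry.HodgeTheory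

section HodgeTheory

open Literature.AlgebraicTopology.SingularHomology
open Literature.AlgebraicGeometry.Motives
open Literature.Barriers.HodgeConjecture (divisorClassesSpan)

variable {A₁ A₂ : Motives.AbelianVariety ℂ} {φ₁ : A₁ ⟶ A₁} {φ₂ : A₂ ⟶ A₂} {Ψ : A₁.prod A₂ ⟶ A₁.prod A₂}
  {P : Polynomial ℤ} {e r₁ r₂ : ℕ}

/-! ### §1 Integral polynomials in the diagonal endomorphism are diagonal -/

section Diagonal

/-- **`Q(φ₁ × φ₂) = Q(φ₁) × Q(φ₂)`**: if `Ψ ≫ fst = fst ≫ φ₁` and `Ψ ≫ snd = snd ≫ φ₂` (i.e. `Ψ = φ₁ × φ₂` on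
`A₁ × A₂`) and `χᵢ = Q(φᵢ)` in `End Aᵢ` for some `Q ∈ ℤ[T]`, then `Q(Ψ) = prodLift (fst ≫ χ₁) (snd ≫ χ₂) = χ₁ × χ₂`
in `End(A₁ × A₂)` — the diagonal map `End A₁ × End A₂ → End(A₁ × A₂)`, `(f, g) ↦ (fst ≫ f, snd ≫ g)`, is a ring
homomorphism, and ring homomorphisms commute with the evaluation of integral polynomials.
[cite: MumfordAV1970, §19 (Hom(C, A × B) = Hom(C, A) ⊕ Hom(C, B))]
[cite: MoonenZarhin1998WeilClasses, §2 (the diagonal action; chunk p0002)] -/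
theorem eval₂_prodLift_fst_snd (hΨ₁ : Ψ ≫ AbelianVariety.fst A₁ A₂ = AbelianVariety.fst A₁ A₂ ≫ φ₁)
    (hΨ₂ : Ψ ≫ AbelianVariety.snd A₁ A₂ = AbelianVariety.snd A₁ A₂ ≫ φ₂) (Q : Polynomial ℤ)
    {χ₁ : A₁ ⟶ A₁} {χ₂ : A₂ ⟶ A₂}
    (hχ₁ : (χ₁ : CategoryTheory.End A₁) =
      Polynomial.eval₂ (Int.castRingHom (CategoryTheory.End A₁)) (φ₁ : CategoryTheory.End A₁) Q)
    (hχ₂ : (χ₂ : CategoryTheory.End A₂) =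
      Polynomial.eval₂ (Int.castRingHom (CategoryTheory.End A₂)) (φ₂ : CategoryTheory.End A₂) Q) :
    Polynomial.eval₂ (Int.castRingHom (CategoryTheory.End (A₁.prod A₂)))
        (Ψ : CategoryTheory.End (A₁.prod A₂)) Q =
      AbelianVariety.prodLift (AbelianVariety.fst A₁ A₂ ≫ χ₁) (AbelianVariety.snd A₁ A₂ ≫ χ₂) := by
  -- the diagonal `End A₁ × End A₂ → End (A₁ × A₂)` is a monoid homomorphism …
  let δ₀ : CategoryTheory.End A₁ × CategoryTheory.End A₂ →* CategoryTheory.End (A₁.prod A₂) :=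
    { toFun := fun f =>
        AbelianVariety.prodLift (AbelianVariety.fst A₁ A₂ ≫ f.1) (AbelianVariety.snd A₁ A₂ ≫ f.2)
      map_one' := AbelianVariety.prod_hom_ext (by simp [End.one_def]) (by simp [End.one_def])
      map_mul' := fun f g =>
        AbelianVariety.prod_hom_ext (by simp [End.mul_def]) (by simp [End.mul_def]) }
  have hδ₀ : ∀ f : CategoryTheory.End A₁ × CategoryTheory.End A₂,
      δ₀ f = AbelianVariety.prodLift (AbelianVariety.fst A₁ A₂ ≫ f.1) (AbelianVariety.snd A₁ A₂ ≫ f.2) :=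
    fun _ => rfl
  -- … and additive (composition is bilinear), hence a ring homomorphism
  let δ : CategoryTheory.End A₁ × CategoryTheory.End A₂ →+* CategoryTheory.End (A₁.prod A₂) :=
    RingHom.mk' δ₀ fun f g => by
      rw [hδ₀, hδ₀, hδ₀]
      show AbelianVariety.prodLift (AbelianVariety.fst A₁ A₂ ≫ (f + g).1) (AbelianVariety.snd A₁ A₂ ≫ (f + g).2) =
        AbelianVariety.prodLift (AbelianVariety.fst A₁ A₂ ≫ f.1) (AbelianVariety.snd A₁ A₂ ≫ f.2) +
          AbelianVariety.prodLift (AbelianVariety.fst A₁ A₂ ≫ g.1) (AbelianVariety.snd A₁ A₂ ≫ g.2)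
      refine AbelianVariety.prod_hom_ext ?_ ?_
      · rw [AbelianVariety.prodLift_fst, Preadditive.add_comp, AbelianVariety.prodLift_fst,
          AbelianVariety.prodLift_fst]
        exact Preadditive.comp_add _ _ _ _ _ _
      · rw [AbelianVariety.prodLift_snd, Preadditive.add_comp, AbelianVariety.prodLift_snd,
          AbelianVariety.prodLift_snd]
        exact Preadditive.comp_add _ _ _ _ _ _
  have hδ : ∀ f : CategoryTheory.End A₁ × CategoryTheory.End A₂,
      δ f = AbelianVariety.prodLift (AbelianVariety.fst A₁ A₂ ≫ f.1) (AbelianVariety.snd A₁ A₂ ≫ f.2) :=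
    fun _ => rfl
  have hΨ : (Ψ : CategoryTheory.End (A₁.prod A₂)) =
      δ ((φ₁ : CategoryTheory.End A₁), (φ₂ : CategoryTheory.End A₂)) := by
    rw [hδ]
    exact AbelianVariety.prod_hom_ext (by simpa using hΨ₁) (by simpa using hΨ₂)
  have hcomp : Int.castRingHom (CategoryTheory.End (A₁.prod A₂)) =
      δ.comp (Int.castRingHom (CategoryTheory.End A₁ × CategoryTheory.End A₂)) := RingHom.ext_int _ _
  -- evaluation in the product ring is evaluation in each component
  have h1 : (Polynomial.eval₂ (Int.castRingHom (CategoryTheory.End A₁ × CategoryTheory.End A₂))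
      ((φ₁ : CategoryTheory.End A₁), (φ₂ : CategoryTheory.End A₂)) Q).1 =
      Polynomial.eval₂ (Int.castRingHom (CategoryTheory.End A₁)) (φ₁ : CategoryTheory.End A₁) Q := by
    have hint : Int.castRingHom (CategoryTheory.End A₁) =
        (RingHom.fst (CategoryTheory.End A₁) (CategoryTheory.End A₂)).comp
          (Int.castRingHom (CategoryTheory.End A₁ × CategoryTheory.End A₂)) := RingHom.ext_int _ _
    rw [hint]
    exact Polynomial.hom_eval₂ Q (Int.castRingHom (CategoryTheory.End A₁ × CategoryTheory.End A₂))
      (RingHom.fst (CategoryTheory.End A₁) (CategoryTheory.End A₂))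
      ((φ₁ : CategoryTheory.End A₁), (φ₂ : CategoryTheory.End A₂))
  have h2 : (Polynomial.eval₂ (Int.castRingHom (CategoryTheory.End A₁ × CategoryTheory.End A₂))
      ((φ₁ : CategoryTheory.End A₁), (φ₂ : CategoryTheory.End A₂)) Q).2 =
      Polynomial.eval₂ (Int.castRingHom (CategoryTheory.End A₂)) (φ₂ : CategoryTheory.End A₂) Q := by
    have hint : Int.castRingHom (CategoryTheory.End A₂) =
        (RingHom.snd (CategoryTheory.End A₁) (CategoryTheory.End A₂)).comp
          (Int.castRingHom (CategoryTheory.End A₁ × CategoryTheory.End A₂)) := RingHom.ext_int _ _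
    rw [hint]
    exact Polynomial.hom_eval₂ Q (Int.castRingHom (CategoryTheory.End A₁ × CategoryTheory.End A₂))
      (RingHom.snd (CategoryTheory.End A₁) (CategoryTheory.End A₂))
      ((φ₁ : CategoryTheory.End A₁), (φ₂ : CategoryTheory.End A₂))
  rw [hcomp, hΨ, ← Polynomial.hom_eval₂, hδ, h1, h2, ← hχ₁, ← hχ₂]

/-- **`P(φ₁) = 0` and `P(φ₂) = 0` ⟹ `P(φ₁ × φ₂) = 0`** in `End(A₁ × A₂)`: the same field `F = ℚ[T]/(P)` acts diagonally
on the product. [cite: MoonenZarhin1998WeilClasses, §2 (the diagonal action; chunk p0002)] [cite: MumfordAV1970, §19] -/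
theorem eval₂_prodLift_fst_snd_eq_zero (hΨ₁ : Ψ ≫ AbelianVariety.fst A₁ A₂ = AbelianVariety.fst A₁ A₂ ≫ φ₁)
    (hΨ₂ : Ψ ≫ AbelianVariety.snd A₁ A₂ = AbelianVariety.snd A₁ A₂ ≫ φ₂)
    (hφ₁ : Polynomial.eval₂ (Int.castRingHom (CategoryTheory.End A₁)) (φ₁ : CategoryTheory.End A₁) P = 0)
    (hφ₂ : Polynomial.eval₂ (Int.castRingHom (CategoryTheory.End A₂)) (φ₂ : CategoryTheory.End A₂) P = 0) :
    Polynomial.eval₂ (Int.castRingHom (CategoryTheory.End (A₁.prod A₂)))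
      (Ψ : CategoryTheory.End (A₁.prod A₂)) P = 0 := by
  rw [eval₂_prodLift_fst_snd hΨ₁ hΨ₂ P (χ₁ := 0) (χ₂ := 0) hφ₁.symm hφ₂.symm]
  show AbelianVariety.prodLift (AbelianVariety.fst A₁ A₂ ≫ 0) (AbelianVariety.snd A₁ A₂ ≫ 0) =
    (0 : A₁.prod A₂ ⟶ A₁.prod A₂)
  exact AbelianVariety.prod_hom_ext (by simp) (by simp)

end Diagonal

/-! ### §2 The `W_F(A₁ × A₂)`-line above `ρ` is the exterior product of the `W_F(Aᵢ)`-lines above `ρ` -/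

section Line

/-- **`fst^* ⋀ᵏ V_ρ(φ₁) ⌣ snd^* ⋀ˡ V_ρ(φ₂) ⊆ (⋀^{k+l} V_ρ(Ψ))`-line**: the exterior product of a class of the
`(x + yρ)^k`-eigenclasses of `(A₁, φ₁)` and a class of the `(x + yρ)^l`-eigenclasses of `(A₂, φ₂)` is a
`(x + yρ)^{k+l}`-eigenclass of `(A₁ × A₂, Ψ)` (naturality and multiplicativity of pull-backs,
`cupProduct_map_fst_map_snd_mem_pullbackEigenclasses`). [cite: Schoen1998HodgeWeilAddendum, §10 (proof, p. 333)]
[cite: MoonenZarhin1998WeilClasses, §2 (chunk p0002)] [cite: HatcherAT2002, §3.2 Prop. 3.10] -/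
theorem cupProduct_map_fst_map_snd_mem_pullbackEigenclasses_pow
    (hΨ₁ : Ψ ≫ AbelianVariety.fst A₁ A₂ = AbelianVariety.fst A₁ A₂ ≫ φ₁)
    (hΨ₂ : Ψ ≫ AbelianVariety.snd A₁ A₂ = AbelianVariety.snd A₁ A₂ ≫ φ₂) {k l m : ℕ} (h : k + l = m) {ρ : ℂ}
    {a : complexBetti A₁.X k} {b : complexBetti A₂.X l}
    (ha : a ∈ pullbackEigenclasses A₁ φ₁ k (fun x y => ((x : ℂ) + (y : ℂ) * ρ) ^ k))
    (hb : b ∈ pullbackEigenclasses A₂ φ₂ l (fun x y => ((x : ℂ) + (y : ℂ) * ρ) ^ l)) :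
    cupProduct h (complexBetti.map (AbelianVariety.fst A₁ A₂).hom.hom.hom k a)
        (complexBetti.map (AbelianVariety.snd A₁ A₂).hom.hom.hom l b) ∈
      pullbackEigenclasses (A₁.prod A₂) Ψ m (fun x y => ((x : ℂ) + (y : ℂ) * ρ) ^ m) := by
  have key := cupProduct_map_fst_map_snd_mem_pullbackEigenclasses h hΨ₁ hΨ₂ ha hb
  have hχ : (fun x y : ℕ => ((x : ℂ) + (y : ℂ) * ρ) ^ k * ((x : ℂ) + (y : ℂ) * ρ) ^ l) =
      fun x y : ℕ => ((x : ℂ) + (y : ℂ) * ρ) ^ m := by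
    funext x y
    rw [← pow_add, h]
  rw [hχ] at key
  exact key

/-- **THE `W_F(A₁ × A₂)`-LINE ABOVE `ρ` IS THE EXTERIOR PRODUCT OF THE `W_F(A₁)`- AND `W_F(A₂)`-LINES ABOVE `ρ`**
(Moonen–Zarhin §2: `W_F(X) = W_F(Y₁^{m₁}) ⊗_F W_F(Y₂^{m₂})` inside the Künneth component; Schoen's display
`ω_{1,σ} ∧ ⋯ ∧ ω_{6,σ} = (ω_{1,σ} ∧ ⋯ ∧ ω_{4,σ}) ∧ (ω_{5,σ} ∧ ω_{6,σ})`).  For `P` monic irreducible of degree `e`,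
`P(φᵢ) = 0`, `e · rᵢ = 2 dim Aᵢ`, `Ψ = φ₁ × φ₂`, a complex root `ρ` of `P` and NON-ZERO classes `ωᵢ` on the lines
`⋀^{rᵢ} V_ρ(φᵢ)`: `pullbackEigenclasses (A₁ × A₂) Ψ (r₁ + r₂) ((x + yρ)^{r₁+r₂}) = ℂ · (fst^* ω₁ ⌣ snd^* ω₂)` — the
product lies on the line (previous theorem), is non-zero (Künneth: `cupProduct_map_fst_map_snd_ne_zero_of_add_eq`),
and the line has dimension `≤ 1` (`P(Ψ) = 0` with `e(r₁ + r₂) = 2 dim(A₁ × A₂)` gives `dim V_ρ(Ψ) = r₁ + r₂`,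
`finrank_pullbackEigenclasses_pow_le_one`). [cite: MoonenZarhin1998WeilClasses, §2 (chunk p0002)]
[cite: Schoen1998HodgeWeilAddendum, §10 (proof, p. 333)] [cite: HatcherAT2002, §3.2 Thm. 3.16] -/
theorem pullbackEigenclasses_prod_eq_span_cupProduct
    (hΨ₁ : Ψ ≫ AbelianVariety.fst A₁ A₂ = AbelianVariety.fst A₁ A₂ ≫ φ₁)
    (hΨ₂ : Ψ ≫ AbelianVariety.snd A₁ A₂ = AbelianVariety.snd A₁ A₂ ≫ φ₂) (hPm : P.Monic) (hPe : P.natDegree = e)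
    (hPirr : Irreducible (P.map (Int.castRingHom ℚ)))
    (hφ₁ : Polynomial.eval₂ (Int.castRingHom (CategoryTheory.End A₁)) (φ₁ : CategoryTheory.End A₁) P = 0)
    (hφ₂ : Polynomial.eval₂ (Int.castRingHom (CategoryTheory.End A₂)) (φ₂ : CategoryTheory.End A₂) P = 0)
    (her₁ : e * r₁ = 2 * A₁.dim) (her₂ : e * r₂ = 2 * A₂.dim)
    {ρ : ℂ} (hρ : Polynomial.eval₂ (Int.castRingHom ℂ) ρ P = 0) {m : ℕ} (h : r₁ + r₂ = m)
    {ω₁ : complexBetti A₁.X r₁} (hω₁ : ω₁ ∈ pullbackEigenclasses A₁ φ₁ r₁ (fun x y => ((x : ℂ) + (y : ℂ) * ρ) ^ r₁))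
    (hω₁0 : ω₁ ≠ 0)
    {ω₂ : complexBetti A₂.X r₂} (hω₂ : ω₂ ∈ pullbackEigenclasses A₂ φ₂ r₂ (fun x y => ((x : ℂ) + (y : ℂ) * ρ) ^ r₂))
    (hω₂0 : ω₂ ≠ 0) :
    pullbackEigenclasses (A₁.prod A₂) Ψ m (fun x y => ((x : ℂ) + (y : ℂ) * ρ) ^ m) =
      Submodule.span ℂ {cupProduct h (complexBetti.map (AbelianVariety.fst A₁ A₂).hom.hom.hom r₁ ω₁)
        (complexBetti.map (AbelianVariety.snd A₁ A₂).hom.hom.hom r₂ ω₂)} := by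
  subst h
  haveI := finite_complexBetti_abelianVariety (A₁.prod A₂) 1
  haveI := finite_complexBetti_abelianVariety (A₁.prod A₂) (r₁ + r₂)
  have hX₁ : IsSmoothProjective A₁.dim A₁.X := Motives.AbelianVariety.isSmoothProjective_holds (A := A₁)
  have hX₂ : IsSmoothProjective A₂.dim A₂.X := Motives.AbelianVariety.isSmoothProjective_holds (A := A₂)
  -- the exterior product lies on the line and is non-zero
  have hmem := cupProduct_map_fst_map_snd_mem_pullbackEigenclasses_pow hΨ₁ hΨ₂ (rfl : r₁ + r₂ = r₁ + r₂) hω₁ hω₂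
  have he : 0 < e := by
    rw [← hPe, ← natDegree_map_eq_of_injective (RingHom.injective_int (Int.castRingHom ℚ)) P]
    exact natDegree_pos_iff_degree_pos.2 (degree_pos_of_irreducible hPirr)
  have hr₂ : r₂ ≤ 2 * A₂.dim := by
    rw [← her₂]
    exact Nat.le_mul_of_pos_left r₂ he
  have hne : cupProduct (rfl : r₁ + r₂ = r₁ + r₂) (complexBetti.map (AbelianVariety.fst A₁ A₂).hom.hom.hom r₁ ω₁)
      (complexBetti.map (AbelianVariety.snd A₁ A₂).hom.hom.hom r₂ ω₂) ≠ 0 :=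
    cupProduct_map_fst_map_snd_ne_zero_of_add_eq hX₁ hX₂ rfl hr₂ hω₁0 hω₂0
  -- `P(Ψ) = 0`, so `Ψ^*` is semisimple and `dim V_ρ(Ψ) = r₁ + r₂`; the line has dimension `≤ 1`
  have hΨ := eval₂_prodLift_fst_snd_eq_zero hΨ₁ hΨ₂ hφ₁ hφ₂
  have herΨ : e * (r₁ + r₂) = 2 * (A₁.prod A₂).dim := by
    rw [AbelianVariety.dim_prod, mul_add, her₁, her₂, mul_add]
  have hss : Module.End.IsSemisimple (complexBetti.map Ψ.hom.hom.hom 1).hom := by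
    have hsepC : (P.map (Int.castRingHom ℂ)).Separable := by
      rw [map_castRingHom_complex_eq]; exact hPirr.separable.map
    exact Module.End.isSemisimple_of_squarefree_aeval_eq_zero hsepC.squarefree
      (aeval_hom_complexBetti_map_one_eq_zero hΨ)
  have hle := (finrank_pullbackEigenclasses_pow_le_one (A := A₁.prod A₂) (φ := Ψ) hss (N := r₁ + r₂) ρ
    (finrank_eigenspace_eq_of_root hPm hPe hPirr hΨ herΨ hρ).le).1
  -- a subspace of dimension `≤ 1` containing a non-zero vector is the line it spans
  refine le_antisymm (fun c hc => ?_) ((Submodule.span_singleton_le_iff_mem _ _).2 hmem)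
  have hne' : (⟨_, hmem⟩ : ↥(pullbackEigenclasses (A₁.prod A₂) Ψ (r₁ + r₂)
      (fun x y => ((x : ℂ) + (y : ℂ) * ρ) ^ (r₁ + r₂)))) ≠ 0 :=
    fun h0 => hne (congrArg Subtype.val h0)
  have hpos : 0 < Module.finrank ℂ ↥(pullbackEigenclasses (A₁.prod A₂) Ψ (r₁ + r₂)
      (fun x y => ((x : ℂ) + (y : ℂ) * ρ) ^ (r₁ + r₂))) :=
    Module.finrank_pos_iff_exists_ne_zero.2 ⟨_, hne'⟩
  obtain ⟨t, ht⟩ := (finrank_eq_one_iff_of_nonzero' _ hne').1 (le_antisymm hle hpos) ⟨c, hc⟩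
  rw [Submodule.mem_span_singleton]
  exact ⟨t, congrArg Subtype.val ht⟩

end Line

/-! ### §3 `W_F(A₁ × A₂) ⊗ ℂ` lies in the span of the exterior products of `W_F(A₁) ⊗ ℂ` and `W_F(A₂) ⊗ ℂ` -/

section Product

/-- **`W_F(A₁ × A₂) ⊗ ℂ ⊆ span_ℂ {fst^* a ⌣ snd^* b | a ∈ W_F(A₁) ⊗ ℂ, b ∈ W_F(A₂) ⊗ ℂ}`** (Moonen–Zarhin §2,
«`W_F(X)` can be identified with the tensor product `W_F(Y₁^{m₁}) ⊗_F W_F(Y₂^{m₂})`», complexified, as a containment):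
for `P` monic irreducible of degree `e`, `P(φᵢ) = 0`, `e · rᵢ = 2 dim Aᵢ` and `Ψ = φ₁ × φ₂`,
`weilClassesField (A₁ × A₂) Ψ P (r₁ + r₂) ⊆ span (image2 (fst^* · ⌣ snd^* ·) (weilClassesField A₁ φ₁ P r₁) (weilClassesField A₂ φ₂ P r₂))`
— each line of the left side is generated by the product of generators of the factor lines (§2 with
`exists_generator_pullbackEigenclasses_of_root`). [cite: MoonenZarhin1998WeilClasses, §2 (chunk p0002)]
[cite: Schoen1998HodgeWeilAddendum, §10 (proof, p. 333)] -/
theorem weilClassesField_prod_le_span_cupProduct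
    (hΨ₁ : Ψ ≫ AbelianVariety.fst A₁ A₂ = AbelianVariety.fst A₁ A₂ ≫ φ₁)
    (hΨ₂ : Ψ ≫ AbelianVariety.snd A₁ A₂ = AbelianVariety.snd A₁ A₂ ≫ φ₂) (hPm : P.Monic) (hPe : P.natDegree = e)
    (hPirr : Irreducible (P.map (Int.castRingHom ℚ)))
    (hφ₁ : Polynomial.eval₂ (Int.castRingHom (CategoryTheory.End A₁)) (φ₁ : CategoryTheory.End A₁) P = 0)
    (hφ₂ : Polynomial.eval₂ (Int.castRingHom (CategoryTheory.End A₂)) (φ₂ : CategoryTheory.End A₂) P = 0)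
    (her₁ : e * r₁ = 2 * A₁.dim) (her₂ : e * r₂ = 2 * A₂.dim) {m : ℕ} (h : r₁ + r₂ = m) :
    weilClassesField (A₁.prod A₂) Ψ P m ≤
      Submodule.span ℂ (Set.image2
        (fun a b => cupProduct h (complexBetti.map (AbelianVariety.fst A₁ A₂).hom.hom.hom r₁ a)
          (complexBetti.map (AbelianVariety.snd A₁ A₂).hom.hom.hom r₂ b))
        (weilClassesField A₁ φ₁ P r₁ : Set (complexBetti A₁.X r₁)) (weilClassesField A₂ φ₂ P r₂)) := by
  subst h
  refine iSup₂_le fun ρ hρ => ?_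
  obtain ⟨ω₁, hω₁, hω₁0, -, -⟩ := exists_generator_pullbackEigenclasses_of_root hPm hPe hPirr hφ₁ her₁ hρ
  obtain ⟨ω₂, hω₂, hω₂0, -, -⟩ := exists_generator_pullbackEigenclasses_of_root hPm hPe hPirr hφ₂ her₂ hρ
  rw [pullbackEigenclasses_prod_eq_span_cupProduct hΨ₁ hΨ₂ hPm hPe hPirr hφ₁ hφ₂ her₁ her₂ hρ rfl hω₁ hω₁0 hω₂ hω₂0]
  exact Submodule.span_mono (Set.singleton_subset_iff.2
    (Set.mem_image2_of_mem (pullbackEigenclasses_le_weilClassesField hρ hω₁)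
      (pullbackEigenclasses_le_weilClassesField hρ hω₂)))

end Product

/-! ### §4 The product step for any `F`: algebraic / decomposable Weil classes of the factors give those of the product -/

section Consequences

/-- **THE PRODUCT STEP FOR ANY CM FIELD `F`: `W_F(A₁) ⊗ ℂ` and `W_F(A₂) ⊗ ℂ` algebraic ⟹ `W_F(A₁ × A₂) ⊗ ℂ`
algebraic** (`P` monic irreducible of degree `e`, `P(φᵢ) = 0`, `e · 2mᵢ = 2 dim Aᵢ`, `Ψ = φ₁ × φ₂`): the Weil classes
of the product lie in the span of the exterior products `fst^* a ⌣ snd^* b` of Weil classes of the factors (§3), and an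
exterior product of algebraic classes is algebraic (`cupProduct_map_fst_map_snd_mem_algebraicClasses`, Voisin II
Prop. 9.20 / §11.3).  The quadratic case `F = ℚ(√-d)` on the carrier `weilClassesOf` is
`weilClassesOf_prod_le_algebraicClasses` (Schoen 1998 §10 read downward).
[cite: MoonenZarhin1998WeilClasses, §2 (chunk p0002)] [cite: Schoen1998HodgeWeilAddendum, §10 (proof, p. 333)]
[cite: VoisinHodgeII2003, Prop. 9.20] -/
theorem weilClassesField_prod_le_algebraicClasses {m₁ m₂ : ℕ}
    (hΨ₁ : Ψ ≫ AbelianVariety.fst A₁ A₂ = AbelianVariety.fst A₁ A₂ ≫ φ₁)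
    (hΨ₂ : Ψ ≫ AbelianVariety.snd A₁ A₂ = AbelianVariety.snd A₁ A₂ ≫ φ₂) (hPm : P.Monic) (hPe : P.natDegree = e)
    (hPirr : Irreducible (P.map (Int.castRingHom ℚ)))
    (hφ₁ : Polynomial.eval₂ (Int.castRingHom (CategoryTheory.End A₁)) (φ₁ : CategoryTheory.End A₁) P = 0)
    (hφ₂ : Polynomial.eval₂ (Int.castRingHom (CategoryTheory.End A₂)) (φ₂ : CategoryTheory.End A₂) P = 0)
    (her₁ : e * (2 * m₁) = 2 * A₁.dim) (her₂ : e * (2 * m₂) = 2 * A₂.dim)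
    (hW₁ : weilClassesField A₁ φ₁ P (2 * m₁) ≤ algebraicClasses A₁.X m₁)
    (hW₂ : weilClassesField A₂ φ₂ P (2 * m₂) ≤ algebraicClasses A₂.X m₂) :
    weilClassesField (A₁.prod A₂) Ψ P (2 * (m₁ + m₂)) ≤ algebraicClasses (A₁.prod A₂).X (m₁ + m₂) := by
  have hX₁ : IsSmoothProjective A₁.dim A₁.X := Motives.AbelianVariety.isSmoothProjective_holds (A := A₁)
  have hX₂ : IsSmoothProjective A₂.dim A₂.X := Motives.AbelianVariety.isSmoothProjective_holds (A := A₂)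
  have h : 2 * m₁ + 2 * m₂ = 2 * (m₁ + m₂) := by ring
  refine (weilClassesField_prod_le_span_cupProduct hΨ₁ hΨ₂ hPm hPe hPirr hφ₁ hφ₂ her₁ her₂ h).trans ?_
  rw [Submodule.span_le]
  rintro _ ⟨a, ha, b, hb, rfl⟩
  exact cupProduct_map_fst_map_snd_mem_algebraicClasses hX₁ hX₂ (hW₁ ha) (hW₂ hb)

/-- **The product step for the divisor ring**: `W_F(A₁) ⊗ ℂ ⊆ D(A₁) ⊗ ℂ` and `W_F(A₂) ⊗ ℂ ⊆ D(A₂) ⊗ ℂ` ⟹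
`W_F(A₁ × A₂) ⊗ ℂ ⊆ D(A₁ × A₂) ⊗ ℂ` — the «⟸» of Moonen–Zarhin's display «`W_F(X)` consists of decomposable Hodge
classes ⟺ each of the spaces `W_F(Y_i^{m_i})` consists of decomposable Hodge classes» for two factors (pull-backs and
cup products of divisor monomials are divisor monomials: `AbelianVariety.map_mem_divisorClassesSpan`,
`cupProduct_mem_divisorClassesSpan_of_mem`). [cite: MoonenZarhin1998WeilClasses, §2 (chunk p0002, lines 21–31)]
[cite: vanGeemen1994HodgeAV, §2.4] -/
theorem weilClassesField_prod_le_divisorClassesSpan {m₁ m₂ : ℕ}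
    (hΨ₁ : Ψ ≫ AbelianVariety.fst A₁ A₂ = AbelianVariety.fst A₁ A₂ ≫ φ₁)
    (hΨ₂ : Ψ ≫ AbelianVariety.snd A₁ A₂ = AbelianVariety.snd A₁ A₂ ≫ φ₂) (hPm : P.Monic) (hPe : P.natDegree = e)
    (hPirr : Irreducible (P.map (Int.castRingHom ℚ)))
    (hφ₁ : Polynomial.eval₂ (Int.castRingHom (CategoryTheory.End A₁)) (φ₁ : CategoryTheory.End A₁) P = 0)
    (hφ₂ : Polynomial.eval₂ (Int.castRingHom (CategoryTheory.End A₂)) (φ₂ : CategoryTheory.End A₂) P = 0)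
    (her₁ : e * (2 * m₁) = 2 * A₁.dim) (her₂ : e * (2 * m₂) = 2 * A₂.dim)
    (hW₁ : weilClassesField A₁ φ₁ P (2 * m₁) ≤ divisorClassesSpan A₁.X A₁.dim m₁)
    (hW₂ : weilClassesField A₂ φ₂ P (2 * m₂) ≤ divisorClassesSpan A₂.X A₂.dim m₂) :
    weilClassesField (A₁.prod A₂) Ψ P (2 * (m₁ + m₂)) ≤
      divisorClassesSpan (A₁.prod A₂).X (A₁.prod A₂).dim (m₁ + m₂) := by
  have h : 2 * m₁ + 2 * m₂ = 2 * (m₁ + m₂) := by ring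
  refine (weilClassesField_prod_le_span_cupProduct hΨ₁ hΨ₂ hPm hPe hPirr hφ₁ hφ₂ her₁ her₂ h).trans ?_
  rw [Submodule.span_le]
  rintro _ ⟨a, ha, b, hb, rfl⟩
  exact cupProduct_mem_divisorClassesSpan_of_mem rfl h
    (AbelianVariety.map_mem_divisorClassesSpan (AbelianVariety.fst A₁ A₂) (hW₁ ha))
    (AbelianVariety.map_mem_divisorClassesSpan (AbelianVariety.snd A₁ A₂) (hW₂ hb))

end Consequences

/-! ### §5 Powers `A^{a+1}` with the diagonal action `φ^{a+1}` (Moonen–Zarhin's `X ∼ Y^m`) -/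

section Powers

open Literature.AlgebraicGeometry.Milne1999 (powFst powSnd powPair powPair_powFst powPair_powSnd)

variable {A : Motives.AbelianVariety ℂ} {φ : A ⟶ A}

/-- `dim A^{a+1} = (a + 1) dim A`. [folklore] -/
private theorem dim_powSucc_eq (A : Motives.AbelianVariety ℂ) : ∀ a : ℕ, (A.powSucc a).dim = (a + 1) * A.dim
  | 0 => by simp
  | a + 1 => by
    show ((A.powSucc a).prod A).dim = (a + 1 + 1) * A.dim
    rw [AbelianVariety.dim_prod, dim_powSucc_eq A a]
    ring

/-- **`P(φ) = 0` ⟹ `P(φ^{a+1}) = 0`** for the diagonal endomorphism `powSuccMap φ a` of `A^{a+1}` (induction on `a`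
with §1: `A^{a+2} = A^{a+1} × A`, `φ^{a+2} = (φ^{a+1}, φ)`). [cite: MoonenZarhin1998WeilClasses, §2 (X ∼ Y^m; chunk p0002)]
[cite: MumfordAV1970, §19] -/
theorem eval₂_powSuccMap_eq_zero
    (hφ : Polynomial.eval₂ (Int.castRingHom (CategoryTheory.End A)) (φ : CategoryTheory.End A) P = 0) :
    ∀ a : ℕ, Polynomial.eval₂ (Int.castRingHom (CategoryTheory.End (A.powSucc a)))
      (powSuccMap φ a : CategoryTheory.End (A.powSucc a)) P = 0
  | 0 => by
    rw [powSuccMap_zero_eq]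
    exact hφ
  | a + 1 => by
    rw [powSuccMap_succ_eq_powPair]
    exact eval₂_prodLift_fst_snd_eq_zero (A₁ := A.powSucc a) (A₂ := A) (powPair_powFst _ _ _) (powPair_powSnd _ _ _)
      (eval₂_powSuccMap_eq_zero hφ a) hφ

/-- **`W_F(A) ⊗ ℂ` ALGEBRAIC ⟹ `W_F(A^{a+1}) ⊗ ℂ` ALGEBRAIC FOR EVERY POWER with the diagonal action of `F`**
(`P` monic irreducible of degree `e`, `P(φ) = 0`, `e · 2m = 2 dim A`; degree `2(a+1)m` on `A^{a+1}`): induction on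
`a` with the product step. [cite: MoonenZarhin1998WeilClasses, §2 (X ∼ Y^m; chunk p0002)]
[cite: Schoen1998HodgeWeilAddendum, §10 (proof, p. 333)] [cite: VoisinHodgeII2003, Prop. 9.20] -/
theorem weilClassesField_powSucc_le_algebraicClasses {m : ℕ} (hPm : P.Monic) (hPe : P.natDegree = e)
    (hPirr : Irreducible (P.map (Int.castRingHom ℚ)))
    (hφ : Polynomial.eval₂ (Int.castRingHom (CategoryTheory.End A)) (φ : CategoryTheory.End A) P = 0)
    (her : e * (2 * m) = 2 * A.dim) (hW : weilClassesField A φ P (2 * m) ≤ algebraicClasses A.X m) :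
    ∀ a : ℕ, weilClassesField (A.powSucc a) (powSuccMap φ a) P (2 * ((a + 1) * m)) ≤
      algebraicClasses (A.powSucc a).X ((a + 1) * m)
  | 0 => by
    rw [powSuccMap_zero_eq, show (0 + 1) * m = m by ring]
    exact hW
  | a + 1 => by
    rw [powSuccMap_succ_eq_powPair, show (a + 1 + 1) * m = (a + 1) * m + m by ring]
    have hera : e * (2 * ((a + 1) * m)) = 2 * (A.powSucc a).dim := by
      rw [dim_powSucc_eq, show e * (2 * ((a + 1) * m)) = (a + 1) * (e * (2 * m)) by ring, her]
      ring
    exact weilClassesField_prod_le_algebraicClasses (A₁ := A.powSucc a) (A₂ := A) (powPair_powFst _ _ _)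
      (powPair_powSnd _ _ _) hPm hPe hPirr (eval₂_powSuccMap_eq_zero hφ a) hφ hera her
      (weilClassesField_powSucc_le_algebraicClasses hPm hPe hPirr hφ her hW a) hW

/-- **`W_F(A) ⊗ ℂ ⊆ D(A) ⊗ ℂ` ⟹ `W_F(A^{a+1}) ⊗ ℂ ⊆ D(A^{a+1}) ⊗ ℂ` for every power** with the diagonal action of `F`
(Moonen–Zarhin's «⟸» for `X = Y^m`). [cite: MoonenZarhin1998WeilClasses, §2 (chunk p0002, lines 21–31)]
[cite: vanGeemen1994HodgeAV, §2.4] -/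
theorem weilClassesField_powSucc_le_divisorClassesSpan {m : ℕ} (hPm : P.Monic) (hPe : P.natDegree = e)
    (hPirr : Irreducible (P.map (Int.castRingHom ℚ)))
    (hφ : Polynomial.eval₂ (Int.castRingHom (CategoryTheory.End A)) (φ : CategoryTheory.End A) P = 0)
    (her : e * (2 * m) = 2 * A.dim) (hW : weilClassesField A φ P (2 * m) ≤ divisorClassesSpan A.X A.dim m) :
    ∀ a : ℕ, weilClassesField (A.powSucc a) (powSuccMap φ a) P (2 * ((a + 1) * m)) ≤
      divisorClassesSpan (A.powSucc a).X (A.powSucc a).dim ((a + 1) * m)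
  | 0 => by
    rw [powSuccMap_zero_eq, show (0 + 1) * m = m by ring]
    exact hW
  | a + 1 => by
    rw [powSuccMap_succ_eq_powPair, show (a + 1 + 1) * m = (a + 1) * m + m by ring]
    have hera : e * (2 * ((a + 1) * m)) = 2 * (A.powSucc a).dim := by
      rw [dim_powSucc_eq, show e * (2 * ((a + 1) * m)) = (a + 1) * (e * (2 * m)) by ring, her]
      ring
    exact weilClassesField_prod_le_divisorClassesSpan (A₁ := A.powSucc a) (A₂ := A) (powPair_powFst _ _ _)
      (powPair_powSnd _ _ _) hPm hPe hPirr (eval₂_powSuccMap_eq_zero hφ a) hφ hera her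
      (weilClassesField_powSucc_le_divisorClassesSpan hPm hPe hPirr hφ her hW a) hW

end Powers

end HodgeTheory

end Literature.AlgebraicGeometry.HodgeTheory
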